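import Literature.RingTheory.KTheory.MilnorKSumOfSquares
import HarnessLib

/-!
# THEOREM 1.4, the generator clause: if `−1` is a sum of squares, every generator `γ = l(a₁)⋯l(aₙ)` of `K_nF`,
# `n ≥ 1`, is nilpotent (Milnor, *Algebraic K-theory and quadratic forms*, Invent. Math. 9 (1970), §1)

Family `hodge`, lane `lit-hodgefound` (foundations library; seat `lit-hodgefound-p27`, generation 40, row g40-#6);
topic `RingTheory/KTheory`.  Sequel of `MilnorKSumOfSquares` (g40-#4: THEOREM 1.4 in pivot form
`isSumSq_neg_one_iff : IsSumSq (−1) ↔ ∃ r, l(−1)^{r+1} = 0`, `symbol_neg_one_eq_zero_of_le`, `symbol_neg_one_ne_zero`),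
`MilnorKTameSymbol` (g40-#1: Lemma 1.2 at a pair of slots one of which is slot `0`, `symbol_eq_symbol_update_neg_one`)
and `MilnorKRing` (g39-#14: the products `mul`, `mul_symbol_symbol : {a}·{b} = {a, b}`, the degree casts `castEquiv`,
LEMMA 1.1 `symbol_append_comm : {b, a} = (−1)^{mn} {a, b}`).  PROVED THEOREMS only; no definition, no named fact, no
instance, no notation, 0 `sorry`, net debt 0 (D-0026).

## The source, verbatim

J. Milnor, *Algebraic K-theory and quadratic forms*, Invent. Math. 9 (1970) 318–344 (held `paper:doi-10-1007-bf01425486`;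
bib key `Milnor1970`), §1, proof of THEOREM 1.4 («The element −1 is a sum of squares in F if and only if every positive
dimensional element of K_*F is nilpotent»), the converse half (p0003 L43–L52): «Conversely, if say −1 = a₁² + ⋯ + a_r²,
then it follows from 1.3 that l(−a₁²)⋯l(−a_r²) = 0; hence l(−1)^r ≡ 0 mod 2K_rF. Since 2l(−1) = 0, it follows
immediately that l(−1)^{r+1} = 0. For any generator γ = l(a₁)⋯l(aₙ) of the group K_nF, it follows from 1.2 that γ^s
is equal to a multiple of l(−1)^{n(s−1)}. Hence γ^s = 0 whenever n(s−1) > r. Similarly, for any sum γ₁ + ⋯ + γ_k of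
generators, the power (γ₁ + ⋯ + γ_k)^s can be expressed as a linear combination of monomials γ₁^{i₁}⋯γ_k^{i_k} with
i₁ + ⋯ + i_k = s. […]»; LEMMA 1.2 (p0002 L47): «For every ξ ∈ K₁F, the identity ξ² = ξ·l(−1) holds».

## What is formalised

The power `γ^s` of a generator `γ = {a₁, …, aₙ} = symbol a` of `K_nF` is the symbol of the `s`-fold repeated tuple
`{a₁, …, aₙ, a₁, …, aₙ, …} = symbol (Fin.repeat s a) ∈ K_{sn}F` (`mul_symbol_symbol_repeat : γ·γ^t = γ^{t+1}` through the
degree identification `castEquiv : K_{n+tn} = K_{(t+1)n}` of `MilnorKRing`); the graded ring `K_*F` enters only through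
its homogeneous products `MilnorK.mul`.

* §1 «it follows from 1.2»: **`symbol_eq_update_neg_one_of_eq`** — Lemma 1.2 at two arbitrary slots `i ≠ j` of a
  symbol over any field (`{…, x, …, x, …} = {…, x, …, −1, …}`; the slot-`0` case is `symbol_eq_symbol_update_neg_one` of
  `MilnorKTameSymbol`, the general case by the transposition `(0 i)` and `symbol_comp_swap_of_ne`), and
  **`symbol_append_eq_of_forall_exists`**: a block each of whose entries repeats an entry of the preceding block may be
  replaced by a block of `−1`'s, `{a, d} = {a, −1, …, −1}`.
* §2 «γ^s is equal to a multiple of l(−1)^{n(s−1)}»: **`symbol_repeat_succ_eq`**: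
  `{a}^{t+1} = ± l(−1)^{tn}·{a}` (the sign `(−1)^{tn·n}` of LEMMA 1.1, up to the degree casts), hence «γ^s = 0 whenever
  n(s−1) > r»: **`symbol_repeat_eq_zero_of`** (`l(−1)^{tn} = 0 ⇒ γ^{t+1} = 0`) and
  **`exists_symbol_repeat_eq_zero`**: if `−1` is a sum of squares then for every generator `γ` of `K_nF`, `n ≥ 1`,
  `γ^s = 0` for all large `s`; with the forward half of THEOREM 1.4 (`symbol_neg_one_ne_zero` of `MilnorKSumOfSquares`:
  `l(−1)^s ≠ 0` when `−1` is not a sum of squares, `symbol_repeat_neg_one_ne_zero`) this gives THEOREM 1.4 restricted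
  to generators, **`isSumSq_neg_one_iff_generators_nilpotent`**:
  `IsSumSq (−1 : F) ↔ ∀ n (a : Fin (n+1) → Fˣ), ∃ s, symbol (Fin.repeat (s+1) a) = 0`.

Not here: the clause for sums of generators `(γ₁ + ⋯ + γ_k)^s` and for inhomogeneous elements, which is a statement
about the ring `K_*F = T(K₁F)/⟨l(a) ⊗ l(1−a)⟩` as a whole (row g40-#7 of this seat constructs that ring).

## References

* [Milnor1970] J. Milnor, *Algebraic K-theory and quadratic forms*, Invent. Math. 9 (1970) 318–344 — §1, Lemma 1.2
  (p0002 L47 – p0003 L6), Theorem 1.4 and its proof (p0003 L21–L52).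

Provenance: lane `lit-hodgefound`, seat `lit-hodgefound-p27` gen 40 (agent `literature-prover-lit-hodgefound-p27-g40-0`),
row g40-#6.
-/

set_option autoImplicit false

noncomputable section

namespace Literature.RingTheory.KTheory

namespace MilnorK

open Function

variable {F : Type*} [Field F]

/-! ### §1 Lemma 1.2 at two arbitrary slots; replacing repeated entries by `−1` -/

/-- **LEMMA 1.2 at two arbitrary slots** (any field): if two entries of a symbol agree, `aᵢ = aⱼ` with `i ≠ j`, then
`{…, aᵢ, …, aⱼ, …} = {…, aᵢ, …, −1, …}` — the entry at slot `j` may be replaced by `−1`.  (Slot `0` against slot `j`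
is `symbol_eq_symbol_update_neg_one` of `MilnorKTameSymbol`; the general case conjugates by the transposition `(0 i)`,
`symbol_comp_swap_of_ne`.) [cite: Milnor1970, §1 Lemma 1.2 «ξ² = ξ·l(−1)» (p0002 L47) and proof of Theorem 1.4 «it
follows from 1.2» (p0003 L47)] -/
theorem symbol_eq_update_neg_one_of_eq {m : ℕ} (a : Fin m → Fˣ) {i j : Fin m} (hij : i ≠ j) (heq : a i = a j) :
    symbol a = symbol (update a j (-1)) := by
  cases m with
  | zero => exact Fin.elim0 i
  | succ m =>
  by_cases hi : i = 0
  · subst hi; exact symbol_eq_symbol_update_neg_one a (Ne.symm hij) heq.symm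
  by_cases hj : j = 0
  · subst hj
    set c := a ∘ Equiv.swap 0 i with hc
    have hc0 : c i = c 0 := by
      simp only [hc, Function.comp_apply, Equiv.swap_apply_right, Equiv.swap_apply_left]; exact heq.symm
    have h1 : symbol c = -symbol a := symbol_comp_swap_of_ne a (Ne.symm hi)
    have h2 : symbol c = symbol (update c i (-1)) := symbol_eq_symbol_update_neg_one c hi hc0
    have h3 : update c i (-1) = update a 0 (-1) ∘ Equiv.swap 0 i := by
      rw [hc, ← update_comp_eq_of_injective a (Equiv.swap 0 i).injective i (-1), Equiv.swap_apply_right]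
    rw [h2, h3, symbol_comp_swap_of_ne _ (Ne.symm hi), neg_inj] at h1
    exact h1.symm
  · set c := a ∘ Equiv.swap 0 i with hc
    have hcj : c j = c 0 := by
      simp only [hc, Function.comp_apply, Equiv.swap_apply_left, Equiv.swap_apply_of_ne_of_ne hj (Ne.symm hij)]
      exact heq.symm
    have h1 : symbol c = -symbol a := symbol_comp_swap_of_ne a (Ne.symm hi)
    have h2 : symbol c = symbol (update c j (-1)) := symbol_eq_symbol_update_neg_one c hj hcj
    have h3 : update c j (-1) = update a j (-1) ∘ Equiv.swap 0 i := by
      rw [hc, ← update_comp_eq_of_injective a (Equiv.swap 0 i).injective j (-1), Equiv.swap_apply_of_ne_of_ne hj (Ne.symm hij)]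
    rw [h2, h3, symbol_comp_swap_of_ne _ (Ne.symm hi), neg_inj] at h1
    exact h1.symm

/-- Updating an entry of the second block of an appended tuple. [folklore] -/
private theorem update_append_natAdd {α : Type*} {n m : ℕ} (a : Fin n → α) (d : Fin m → α) (p : Fin m) (y : α) :
    update (Fin.append a d) (Fin.natAdd n p) y = Fin.append a (update d p y) := by
  funext k
  refine Fin.addCases (fun i => ?_) (fun j => ?_) k
  · rw [Fin.append_left, update_of_ne]
    · rw [Fin.append_left]
    · intro h; have := congrArg Fin.val h; simp at this; omega
  · rw [Fin.append_right]
    by_cases hj : j = p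
    · subst hj; rw [update_self, update_self]
    · rw [update_of_ne hj, update_of_ne (fun h => hj (Fin.natAdd_injective _ _ h)), Fin.append_right]

/-- **A block repeating earlier entries may be replaced by `−1`'s**: if every entry of `d` equals some entry of `a`,
then `{a, d} = {a, −1, …, −1}` (Lemma 1.2 slot by slot, `symbol_eq_update_neg_one_of_eq`). [cite: Milnor1970, §1
proof of Theorem 1.4 «it follows from 1.2 that γ^s is equal to a multiple of l(−1)^{n(s−1)}» (p0003 L47–L48)] -/
theorem symbol_append_eq_of_forall_exists {n m : ℕ} (a : Fin n → Fˣ) (d : Fin m → Fˣ) (hd : ∀ p, ∃ q, d p = a q) :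
    symbol (Fin.append a d) = symbol (Fin.append a (fun _ : Fin m => (-1 : Fˣ))) := by
  classical
  -- `P k`: the first `k` entries of the second block are already `−1`
  suffices P : ∀ k : ℕ, symbol (Fin.append a d) =
      symbol (Fin.append a (fun p : Fin m => if p.val < k then (-1 : Fˣ) else d p)) by
    have h := P m
    simp only [Fin.is_lt, if_true] at h
    exact h
  intro k
  induction k with
  | zero => simp
  | succ k ih =>
    rw [ih]
    by_cases hk : k < m
    · set pk : Fin m := ⟨k, hk⟩ with hpk
      have heq : (fun p : Fin m => if p.val < k + 1 then (-1 : Fˣ) else d p) =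
          update (fun p : Fin m => if p.val < k then (-1 : Fˣ) else d p) pk (-1) := by
        funext p
        by_cases hp : p = pk
        · subst hp; rw [update_self, if_pos (by simp [hpk])]
        · rw [update_of_ne hp]
          have hne : p.val ≠ k := fun h => hp (Fin.ext (by rw [hpk]; exact h))
          by_cases hlt : p.val < k
          · rw [if_pos hlt, if_pos (by omega)]
          · rw [if_neg hlt, if_neg (by omega)]
      rw [heq, ← update_append_natAdd]
      obtain ⟨q, hq⟩ := hd pk
      refine symbol_eq_update_neg_one_of_eq _ (i := Fin.castAdd m q) (j := Fin.natAdd n pk) ?_ ?_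
      · intro h; have := congrArg Fin.val h; simp at this; omega
      · rw [Fin.append_left, Fin.append_right, if_neg (by simp [hpk]), hq]
    · congr 2
      funext p
      have : p.val < k := lt_of_lt_of_le p.isLt (not_lt.1 hk)
      rw [if_pos this, if_pos (by omega)]

/-! ### §2 powers of a generator: `γ^s = {a, a, …, a}` -/

/-- **`γ·γ^t = γ^{t+1}`**: for a generator `γ = {a}` of `K_nF`, `{a}·{a, …, a} = {a, a, …, a}` — the powers of `γ` in the
graded ring `K_*F` are the symbols of the repeated tuples `Fin.repeat s a`, through the degree identification
`K_{n+tn} = K_{(t+1)n}` (`castEquiv` of `MilnorKRing`). [cite: Milnor1970, §1 «γ = l(a₁)⋯l(aₙ) […] γ^s» (p0003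
L47–L48)] -/
theorem mul_symbol_symbol_repeat {n : ℕ} (a : Fin n → Fˣ) (t : ℕ) :
    mul F n (t * n) (symbol a) (symbol (Fin.repeat t a)) =
      castEquiv ((Nat.succ_mul t n).trans (Nat.add_comm _ _)) (symbol (Fin.repeat (t + 1) a)) := by
  rw [mul_symbol_symbol, Fin.repeat_succ, symbol_comp_cast, castEquiv_symm, castEquiv_trans, castEquiv_rfl]

/-- Every entry of a repeated tuple is an entry of the tuple. [folklore] -/
private theorem repeat_exists {α : Type*} {n : ℕ} (a : Fin n → α) (t : ℕ) (p : Fin (t * n)) : ∃ q, Fin.repeat t a p = a q :=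
  ⟨p.modNat, Fin.repeat_apply a p⟩

/-- **«γ^s is equal to a multiple of l(−1)^{n(s−1)}»**: for `γ = {a} ∈ K_nF`,
`γ^{t+1} = {a, a, …, a} = (−1)^{tn·n} · l(−1)^{tn}·γ` up to the degree identifications `castEquiv` (the block of
`t` repetitions is replaced by `−1`'s, `symbol_append_eq_of_forall_exists`, and moved to the front by LEMMA 1.1,
`symbol_append_comm`). [cite: Milnor1970, §1 proof of Theorem 1.4 (p0003 L47–L48)] -/
theorem symbol_repeat_succ_eq {n : ℕ} (a : Fin n → Fˣ) (t : ℕ) :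
    symbol (Fin.repeat (t + 1) a) =
      (castEquiv ((Nat.succ_mul t n).trans (Nat.add_comm _ _))).symm
        (((-1 : ℤ) ^ (t * n * n)) • castEquiv (Nat.add_comm (t * n) n)
          (mul F (t * n) n (symbol (fun _ : Fin (t * n) => (-1 : Fˣ))) (symbol a))) := by
  rw [Fin.repeat_succ, symbol_comp_cast, symbol_append_eq_of_forall_exists a _ (repeat_exists a t),
    symbol_append_comm (fun _ : Fin (t * n) => (-1 : Fˣ)) a, mul_symbol_symbol]

/-- **«Hence γ^s = 0 whenever n(s−1) > r»**: if `l(−1)^{tn} = 0` in `K_{tn}F` then `γ^{t+1} = {a, …, a} = 0` for every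
generator `γ = {a}` of `K_nF`. [cite: Milnor1970, §1 proof of Theorem 1.4 (p0003 L48–L49)] -/
theorem symbol_repeat_eq_zero_of {n : ℕ} (a : Fin n → Fˣ) (t : ℕ) (h : symbol (fun _ : Fin (t * n) => (-1 : Fˣ)) = 0) :
    symbol (Fin.repeat (t + 1) a) = 0 := by
  rw [symbol_repeat_succ_eq, h, map_zero, AddMonoidHom.zero_apply, map_zero, zsmul_zero, map_zero]

/-- **THEOREM 1.4, the generator clause**: if `−1` is a sum of squares in `F`, then every generator
`γ = l(a₁)⋯l(aₙ) = {a}` of `K_nF`, `n ≥ 1`, is nilpotent in `K_*F`: `γ^s = {a, a, …, a} = 0` for all large `s`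
(`l(−1)^{r+1} = 0` by `exists_symbol_neg_one_eq_zero` of `MilnorKSumOfSquares`, then `symbol_repeat_eq_zero_of` once
`(s−1)n ≥ r+1`). [cite: Milnor1970, §1 Theorem 1.4 and its proof «Since 2l(−1) = 0, it follows immediately that
l(−1)^{r+1} = 0. For any generator γ = l(a₁)⋯l(aₙ) of the group K_nF […] γ^s = 0 whenever n(s−1) > r» (p0003 L45–L49)] -/
theorem exists_symbol_repeat_eq_zero (h : IsSumSq (-1 : F)) {n : ℕ} (a : Fin (n + 1) → Fˣ) :
    ∃ s₀ : ℕ, ∀ s, s₀ ≤ s → symbol (Fin.repeat (s + 1) a) = 0 := by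
  obtain ⟨r, hr⟩ := exists_symbol_neg_one_eq_zero h
  refine ⟨r + 1, fun s hs => symbol_repeat_eq_zero_of a s (symbol_neg_one_eq_zero_of_le ?_ hr)⟩
  -- `r + 1 ≤ s (n + 1)`
  calc r + 1 ≤ s := hs
    _ ≤ s * (n + 1) := Nat.le_mul_of_pos_right s (Nat.succ_pos n)

/-- Conversely, if `−1` is not a sum of squares then the generator `l(−1)ⁿ = {−1, …, −1}` (any `n`, in particular
`l(−1) ∈ K₁F`) is not nilpotent: `{−1, …, −1}^s ≠ 0` for every `s` (`symbol_neg_one_ne_zero` of `MilnorKSumOfSquares`,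
the sign homomorphism of an ordering). [cite: Milnor1970, §1 proof of Theorem 1.4 «This proves that the element l(−1)
is not nilpotent» (p0003 L42–L43)] -/
theorem symbol_repeat_neg_one_ne_zero (h : ¬ IsSumSq (-1 : F)) (n s : ℕ) :
    symbol (Fin.repeat s (fun _ : Fin n => (-1 : Fˣ))) ≠ 0 := by
  have : Fin.repeat s (fun _ : Fin n => (-1 : Fˣ)) = fun _ => -1 := funext fun i => by rw [Fin.repeat_apply]
  rw [this]
  exact symbol_neg_one_ne_zero h _

/-- **THEOREM 1.4 restricted to generators.** «The element −1 is a sum of squares in F if and only if every positive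
dimensional element of K_*F is nilpotent» — here for the generators `γ = l(a₁)⋯l(aₙ)`, `n ≥ 1`, of the groups `K_nF`,
whose powers are the symbols `γ^s = symbol (Fin.repeat s a)`: `−1` is a sum of squares iff for every `n ≥ 1` and every
`a : Fin n → Fˣ` some power `{a, …, a}` vanishes. (The clause for sums of generators and inhomogeneous elements is a
statement about the ring `K_*F` as a whole and is not part of this file.) [cite: Milnor1970, §1 Theorem 1.4 (p0003
L21–L23) and its proof (p0003 L24–L52)] -/
theorem isSumSq_neg_one_iff_generators_nilpotent :
    IsSumSq (-1 : F) ↔ ∀ (n : ℕ) (a : Fin (n + 1) → Fˣ), ∃ s : ℕ, symbol (Fin.repeat (s + 1) a) = 0 := by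
  refine ⟨fun h n a => ?_, fun h => ?_⟩
  · obtain ⟨s₀, hs₀⟩ := exists_symbol_repeat_eq_zero h a
    exact ⟨s₀, hs₀ s₀ le_rfl⟩
  · by_contra hns
    obtain ⟨s, hs⟩ := h 0 (fun _ => -1)
    exact symbol_repeat_neg_one_ne_zero hns 1 (s + 1) hs

end MilnorK

end Literature.RingTheory.KTheory

end
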